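import Summits.ValiantsHypothesis.ValiantsHypothesis.Theorems.KPlusLogSqLawTropicalBRegisterPairFive
import Summits.ValiantsHypothesis.ValiantsHypothesis.Theorems.KPlusLogSqLawTropicalBRegisterPairCols

/-!
# Route «KPlusLogSqLaw», crux `TropicalB` (stmt-ValiantsHypothesis-19771) — THE FIVE-POINT REGISTER-PAIR LAW, column side

HONEST FRAMING.  Helper toward the registered stubs `stub_tropThin` / `stub_tropFat` of `Cruxes/TropicalB/Lines/birth.lean` (crux
`Summit.ValiantsHypothesis.ValiantsHypothesis.Theses.KPlusLogSqLaw.TropicalB`, item stmt-ValiantsHypothesis-19771, route KPlusLogSqLaw;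
cell `pub-symmetroid`, seat val-sym-trop-p4 g11, 2026-08-27; `--supports … --as helper`).  The five-point law (`RegisterPair.registerPair_five`,
…TropicalBRegisterPairFive) for two registers exposing COLUMN holes read by a gadget of ROWS, by the tree's transposition transport
(`isDominant_transpose_iff`, `tropWeight_transpose`, `termSign_transpose`, …TropicalBTranspose).  A STRUCTURE (no-go) theorem about unique
optima of an arbitrary design; nothing here bounds `TropicalB`, and nothing bears on `WeakLifting`, DoorA26 / DoorA34, `MatrixDescartes`
(stmt-ValiantsHypothesis-18050) or VP ≠ VNP.
[folklore: valuated-matroid exchange (Murota 2003 §9) + hull convexity; transport by transposition; the packaging is the cell's]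
-/

set_option linter.dupNamespace false
set_option autoImplicit false

namespace Summit.ValiantsHypothesis.ValiantsHypothesis.Theorems.KPlusLogSqLaw

namespace RegisterPair

open Summit.ValiantsHypothesis.ValiantsHypothesis.Theorems.MatrixDescartes.Negative
open Summit.ValiantsHypothesis.ValiantsHypothesis.Theorems.LacunarySymmetroidMatrixDescartes
open Summit.ValiantsHypothesis.ValiantsHypothesis.Theorems.LacunarySymmetroidMatrixDescartes.TropicalCensus
open scoped BigOperators
open Finset

variable {m K : ℕ}

/-- the slope is invariant under the transposition transport. [folklore] -/
theorem slope_transpose (d : Fin K → ℕ) (q : Equiv.Perm (Fin m) × (Fin m → Fin K)) :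
    slope d (((q.1⁻¹ : Equiv.Perm (Fin m)), fun j => q.2 (q.1⁻¹ j)) : Equiv.Perm (Fin m) × (Fin m → Fin K)) = slope d q := by
  unfold TropicalCensus.slope
  exact Fintype.sum_equiv q.1⁻¹ _ _ (fun _ => rfl)

/-- **THE FIVE-POINT REGISTER-PAIR LAW, COLUMN SIDE.**  Gadget = a set `G` of ROWS matched (with class `l₀`) onto the columns `N ∪ {cI a, cJ b}`
(`cI`, `cJ` the column holes of two registers), every other row's (column, class) depending on `a` alone or `b` alone, slopes increasing in `a`
and in `b`, all nine terms present; then the five terms `u 0 2, u 1 0, u 1 1, u 2 0, u 2 1` are not all unique optima.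
[folklore; from `registerPair_five` by transposition] -/
theorem registerPair_five_cols (d : Fin K → ℕ) (v ε : Fin m → Fin m → Fin K → ℤ)
    (G N : Finset (Fin m)) (l₀ : Fin K) (cI cJ : Fin 3 → Fin m)
    (u : Fin 3 → Fin 3 → Equiv.Perm (Fin m) × (Fin m → Fin K))
    {θ02 θ10 θ11 θ20 θ21 : ℤ}
    (hd02 : IsDominant d v ε θ02 (u 0 2)) (hd10 : IsDominant d v ε θ10 (u 1 0)) (hd11 : IsDominant d v ε θ11 (u 1 1))
    (hd20 : IsDominant d v ε θ20 (u 2 0)) (hd21 : IsDominant d v ε θ21 (u 2 1))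
    (hpres : ∀ a b, termSign ε (u a b) ≠ 0)
    (hSI : ∀ a a' b, a < a' → slope d (u a b) < slope d (u a' b))
    (hSJ : ∀ a b b', b < b' → slope d (u a b) < slope d (u a b'))
    (hcls : ∀ a b, ∀ r ∈ G, (u a b).2 ((u a b).1⁻¹ r) = l₀)
    (himg : ∀ a b, G.image ⇑(u a b).1⁻¹ = insert (cI a) (insert (cJ b) N))
    (hIN : ∀ a, cI a ∉ N) (hJN : ∀ b, cJ b ∉ N) (hIJ : ∀ a b, cI a ≠ cJ b)
    (hI : Function.Injective cI) (hJ : Function.Injective cJ)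
    (hout : ∀ r, r ∉ G →
      (∀ a b b', ((u a b).1⁻¹ r, (u a b).2 ((u a b).1⁻¹ r)) = ((u a b').1⁻¹ r, (u a b').2 ((u a b').1⁻¹ r))) ∨
      (∀ a a' b, ((u a b).1⁻¹ r, (u a b).2 ((u a b).1⁻¹ r)) = ((u a' b).1⁻¹ r, (u a' b).2 ((u a' b).1⁻¹ r)))) :
    False := by
  -- transposed family, transposed design
  have hT : ∀ a b {θ0 : ℤ}, IsDominant d v ε θ0 (u a b) →
      IsDominant d (fun x y l => v y x l) (fun x y l => ε y x l) θ0
        (((u a b).1⁻¹ : Equiv.Perm (Fin m)), fun j => (u a b).2 ((u a b).1⁻¹ j)) := by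
    intro a b θ0 h
    rw [← isDominant_transpose_iff, transposeTerm_transposeTerm]
    exact h
  refine registerPair_five d (fun x y l => v y x l) (fun x y l => ε y x l) G N l₀ cI cJ
    (fun a b => (((u a b).1⁻¹ : Equiv.Perm (Fin m)), fun j => (u a b).2 ((u a b).1⁻¹ j)))
    (hT 0 2 hd02) (hT 1 0 hd10) (hT 1 1 hd11) (hT 2 0 hd20) (hT 2 1 hd21) ?_ ?_ ?_ hcls himg hIN hJN hIJ hI hJ hout
  · intro a b
    rw [← termSign_transpose, transposeTerm_transposeTerm]
    exact hpres a b
  · intro a a' b h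
    rw [slope_transpose, slope_transpose]; exact hSI a a' b h
  · intro a b b' h
    rw [slope_transpose, slope_transpose]; exact hSJ a b b' h

end RegisterPair

end Summit.ValiantsHypothesis.ValiantsHypothesis.Theorems.KPlusLogSqLaw
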